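import Summits.Ventures.PercRepro.ProfilePointedCircuitClassesStarNineA

/-!
# PercRepro — `(★_3)` AT NINE POINTS, THE BASIS CASE, II: FAMILIES TWO AND THREE
(p5, gen 39; `proofs/P5-GM1.md` §58 ADDENDUM 1 (2))

Continues StarNineA (same setting: the dual `R`, loopless of rank `3` on `9` points, the basis `C₀ = {f, g, k}`,
`H₀ = E − C₀` spanning, `A_c = {z ∈ H₀ : z ∥ c}`, `BS` the bi-spanning triples):
* `mem_family_two`, `exists_family_two` — the triples `{z, z′, c}` with `z ∥ c′`, `z′ ∥ c″` (one point of `C₀`),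
  `#T₂ = a_f a_g + a_f a_k + a_g a_k`;
* `exists_family_three` — when `a_c ≥ 4` (so `a_c = 4`, `#(H₀ − A_c) = 2`), the triples `z + (H₀ − A_c)`, `z ∈ A_c`
  (no point of `C₀`), `#T₃ = a_c`.
-/

open scoped Matroid

namespace PercRepro.Cogirth

open Finset ThmH Skew Shadow Profile

variable {α : Type} [DecidableEq α] {R : Matroid α} [R.Finite]

section Families

variable {f g k : α}

/-- The generic member of family two: for a permutation `(a, b, c)` of the basis, `z ∥ a` and `z′ ∥ b` in `H₀` give the
bi-spanning triple `{z, z′, c}`, which meets the basis exactly in `c`. -/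
theorem mem_family_two (hll : ∀ x ∈ gr R, rk R {x} = 1) (hR3 : rk R (gr R) = 3)
    (hH : rk R (gr R \ {f, g, k}) = 3) {a b c : α} (ha : a ∈ gr R) (hb : b ∈ gr R) (hc : c ∈ gr R)
    (habc : ({a, b, c} : Finset α) = {f, g, k}) (hab : a ≠ b) (hac : a ≠ c) (hbc : b ≠ c)
    (hC : rk R {a, b, c} = 3) {z z' : α}
    (hz : z ∈ (gr R \ {f, g, k}).filter (fun x => rk R {a, x} = 1))
    (hz' : z' ∈ (gr R \ {f, g, k}).filter (fun x => rk R {b, x} = 1)) :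
    ({z, z', c} : Finset α) ∈ ((gr R).powersetCard 3).filter (fun Y => rk R Y = 3 ∧ rk R (gr R \ Y) = 3) ∧
      (({z, z', c} : Finset α) ∩ {f, g, k}).card = 1 ∧ z ≠ z' := by
  rw [mem_filter, mem_sdiff] at hz hz'
  obtain ⟨⟨hzE, hzC⟩, hza⟩ := hz
  obtain ⟨⟨hz'E, hz'C⟩, hz'b⟩ := hz'
  have hle : ∀ X ⊆ gr R, rk R X ≤ 3 := fun X hX => hR3 ▸ rk_mono' hX
  have hcC : c ∈ ({f, g, k} : Finset α) := habc ▸ mem_insert_of_mem (mem_insert_of_mem (mem_singleton_self c))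
  have haC : a ∈ ({f, g, k} : Finset α) := habc ▸ mem_insert_self a {b, c}
  have hbC : b ∈ ({f, g, k} : Finset α) := habc ▸ mem_insert_of_mem (mem_insert_self b {c})
  have hzc : z ≠ c := fun h => hzC (h ▸ hcC)
  have hz'c : z' ≠ c := fun h => hz'C (h ▸ hcC)
  have hab2 : rk R {a, b} = 2 := by
    have := rk_eq_card_of_subset_of_rk_eq_card (M := R) (X := {a, b}) (Y := {a, b, c})
      (insert_subset (mem_insert_self a {b, c}) (singleton_subset_iff.2 (mem_insert_of_mem (mem_insert_self b {c}))))
      (by rw [hC, card_eq_three.2 ⟨a, b, c, hab, hac, hbc, rfl⟩])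
    rwa [card_pair hab] at this
  have hzz' : z ≠ z' := by
    rintro rfl
    have := rk_pair_le_one_of_parallel hll hzE hza hz'b
    omega
  refine ⟨?_, ?_, hzz'⟩
  · rw [mem_filter, mem_powersetCard]
    refine ⟨⟨insert_subset hzE (insert_subset hz'E (singleton_subset_iff.2 hc)),
      card_eq_three.2 ⟨z, z', c, hzz', hzc, hz'c, rfl⟩⟩, ?_, ?_⟩
    · -- `{z, z′, c} + a + b ⊇ {a, b, c}` has the rank of `{z, z′, c}`
      have hY : ({z, z', c} : Finset α) ⊆ gr R := insert_subset hzE (insert_subset hz'E (singleton_subset_iff.2 hc))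
      have e1 := rk_insert_eq_of_rk_pair_eq_one hll hzE ha (by rw [pair_comm]; exact hza) hY (mem_insert_self z {z', c})
      have e2 := rk_insert_eq_of_rk_pair_eq_one hll hz'E hb (by rw [pair_comm]; exact hz'b) (insert_subset ha hY)
        (mem_insert_of_mem (mem_insert_of_mem (mem_insert_self z' {c})))
      have h3 : 3 ≤ rk R (insert b (insert a {z, z', c})) := by
        rw [← hC]
        apply rk_mono'
        intro x hx
        rw [mem_insert, mem_insert, mem_singleton] at hx
        rw [mem_insert, mem_insert, mem_insert, mem_insert, mem_singleton]
        rcases hx with rfl | rfl | rfl <;> simp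
      have h4 := hle _ hY
      omega
    · -- `E − Y + z + z′ ⊇ H₀` has the rank of `E − Y`
      have haY : a ∈ gr R \ {z, z', c} := by
        rw [mem_sdiff, mem_insert, mem_insert, mem_singleton]
        exact ⟨ha, by rintro (rfl | rfl | rfl); exacts [hzC haC, hz'C haC, hac rfl]⟩
      have hbY : b ∈ gr R \ {z, z', c} := by
        rw [mem_sdiff, mem_insert, mem_insert, mem_singleton]
        exact ⟨hb, by rintro (rfl | rfl | rfl); exacts [hzC hbC, hz'C hbC, hbc rfl]⟩
      have e1 := rk_insert_eq_of_rk_pair_eq_one hll ha hzE hza sdiff_subset haY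
      have e2 := rk_insert_eq_of_rk_pair_eq_one hll hb hz'E hz'b (insert_subset hzE sdiff_subset)
        (mem_insert_of_mem hbY)
      have h3 : 3 ≤ rk R (insert z' (insert z (gr R \ {z, z', c}))) := by
        rw [← hH]
        apply rk_mono'
        intro x hx
        rw [mem_sdiff] at hx
        rw [mem_insert, mem_insert, mem_sdiff, mem_insert, mem_insert, mem_singleton]
        by_cases hxz : x = z'
        · exact Or.inl hxz
        by_cases hxz' : x = z
        · exact Or.inr (Or.inl hxz')
        refine Or.inr (Or.inr ⟨hx.1, ?_⟩)
        rintro (rfl | rfl | rfl)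
        · exact hxz' rfl
        · exact hxz rfl
        · exact hx.2 hcC
      have h4 := hle _ (sdiff_subset : gr R \ {z, z', c} ⊆ gr R)
      omega
  · have e : ({z, z', c} : Finset α) ∩ {f, g, k} = {c} := by
      ext x
      simp only [mem_inter, mem_insert, mem_singleton]
      constructor
      · rintro ⟨h1, h2⟩
        rcases h1 with rfl | rfl | rfl
        · exact absurd (by simpa only [mem_insert, mem_singleton] using h2) hzC
        · exact absurd (by simpa only [mem_insert, mem_singleton] using h2) hz'C
        · rfl
      · rintro rfl
        exact ⟨Or.inr (Or.inr rfl), by simpa only [mem_insert, mem_singleton] using hcC⟩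
    rw [e, card_singleton]

/-- **FAMILY TWO**: the bi-spanning triples `{z, z′, c}` with `z ∥ c′`, `z′ ∥ c″`; `#T₂ = a_f a_g + a_f a_k + a_g a_k`. -/
theorem exists_family_two (hll : ∀ x ∈ gr R, rk R {x} = 1) (hR3 : rk R (gr R) = 3)
    (hf : f ∈ gr R) (hg : g ∈ gr R) (hk : k ∈ gr R) (hfg : f ≠ g) (hfk : f ≠ k) (hgk : g ≠ k)
    (hC : rk R {f, g, k} = 3) (hH : rk R (gr R \ {f, g, k}) = 3) :
    ∃ T₂ ⊆ ((gr R).powersetCard 3).filter (fun Y => rk R Y = 3 ∧ rk R (gr R \ Y) = 3),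
      (∀ Y ∈ T₂, (Y ∩ {f, g, k}).card = 1) ∧
      T₂.card = ((gr R \ {f, g, k}).filter (fun z => rk R {f, z} = 1)).card *
          ((gr R \ {f, g, k}).filter (fun z => rk R {g, z} = 1)).card +
        ((gr R \ {f, g, k}).filter (fun z => rk R {f, z} = 1)).card *
          ((gr R \ {f, g, k}).filter (fun z => rk R {k, z} = 1)).card +
        ((gr R \ {f, g, k}).filter (fun z => rk R {g, z} = 1)).card *
          ((gr R \ {f, g, k}).filter (fun z => rk R {k, z} = 1)).card := by
  have hfkg : ({f, k, g} : Finset α) = {f, g, k} := by ext x; simp only [mem_insert, mem_singleton]; tauto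
  have hgkf : ({g, k, f} : Finset α) = {f, g, k} := by ext x; simp only [mem_insert, mem_singleton]; tauto
  have hCfkg : rk R {f, k, g} = 3 := by rw [hfkg]; exact hC
  have hCgkf : rk R {g, k, f} = 3 := by rw [hgkf]; exact hC
  -- the three images
  obtain ⟨Af, hAf⟩ : ∃ A, A = (gr R \ {f, g, k}).filter (fun z => rk R {f, z} = 1) := ⟨_, rfl⟩
  obtain ⟨Ag, hAg⟩ : ∃ A, A = (gr R \ {f, g, k}).filter (fun z => rk R {g, z} = 1) := ⟨_, rfl⟩
  obtain ⟨Ak, hAk⟩ : ∃ A, A = (gr R \ {f, g, k}).filter (fun z => rk R {k, z} = 1) := ⟨_, rfl⟩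
  have hmemH : ∀ A, (A = Af ∨ A = Ag ∨ A = Ak) → ∀ z ∈ A, z ∈ gr R ∧ z ∉ ({f, g, k} : Finset α) := by
    intro A hA z hz
    rcases hA with rfl | rfl | rfl
    · rw [hAf, mem_filter, mem_sdiff] at hz; exact hz.1
    · rw [hAg, mem_filter, mem_sdiff] at hz; exact hz.1
    · rw [hAk, mem_filter, mem_sdiff] at hz; exact hz.1
  have m1 := fun (z z' : α) (hz : z ∈ Af) (hz' : z' ∈ Ag) =>
    mem_family_two (f := f) (g := g) (k := k) hll hR3 hH hf hg hk rfl hfg hfk hgk hC (hAf ▸ hz) (hAg ▸ hz')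
  have m2 := fun (z z' : α) (hz : z ∈ Af) (hz' : z' ∈ Ak) =>
    mem_family_two (f := f) (g := g) (k := k) hll hR3 hH hf hk hg hfkg hfk hfg hgk.symm hCfkg (hAf ▸ hz) (hAk ▸ hz')
  have m3 := fun (z z' : α) (hz : z ∈ Ag) (hz' : z' ∈ Ak) =>
    mem_family_two (f := f) (g := g) (k := k) hll hR3 hH hg hk hf hgkf hgk hfg.symm hfk.symm hCgkf (hAg ▸ hz) (hAk ▸ hz')
  refine ⟨(Af ×ˢ Ag).image (fun p => ({p.1, p.2, k} : Finset α)) ∪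
      (Af ×ˢ Ak).image (fun p => ({p.1, p.2, g} : Finset α)) ∪
      (Ag ×ˢ Ak).image (fun p => ({p.1, p.2, f} : Finset α)), ?_, ?_, ?_⟩
  · intro Y hY
    rw [mem_union, mem_union, mem_image, mem_image, mem_image] at hY
    rcases hY with (⟨p, hp, rfl⟩ | ⟨p, hp, rfl⟩) | ⟨p, hp, rfl⟩ <;> rw [mem_product] at hp
    · exact (m1 p.1 p.2 hp.1 hp.2).1
    · exact (m2 p.1 p.2 hp.1 hp.2).1
    · exact (m3 p.1 p.2 hp.1 hp.2).1
  · intro Y hY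
    rw [mem_union, mem_union, mem_image, mem_image, mem_image] at hY
    rcases hY with (⟨p, hp, rfl⟩ | ⟨p, hp, rfl⟩) | ⟨p, hp, rfl⟩ <;> rw [mem_product] at hp
    · exact (m1 p.1 p.2 hp.1 hp.2).2.1
    · exact (m2 p.1 p.2 hp.1 hp.2).2.1
    · exact (m3 p.1 p.2 hp.1 hp.2).2.1
  · -- the count: the three images are disjoint (which basis point they contain) and injective
    have hnotC : ∀ A, (A = Af ∨ A = Ag ∨ A = Ak) → ∀ z ∈ A, z ≠ f ∧ z ≠ g ∧ z ≠ k := by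
      intro A hA z hz
      have := (hmemH A hA z hz).2
      simp only [mem_insert, mem_singleton, not_or] at this
      exact this
    have hinj : ∀ (A B : Finset α) (c : α), (A = Af ∨ A = Ag ∨ A = Ak) → (B = Af ∨ B = Ag ∨ B = Ak) →
        (c = f ∨ c = g ∨ c = k) → (∀ z ∈ A, ∀ z' ∈ B, z ≠ z') →
        Set.InjOn (fun p : α × α => ({p.1, p.2, c} : Finset α)) ((A ×ˢ B : Finset (α × α)) : Set (α × α)) := by
      intro A B c hA hB hc hAB p hp q hq h
      rw [mem_coe, mem_product] at hp hq
      have h' : ({p.1, p.2, c} : Finset α) = {q.1, q.2, c} := h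
      have hnc : ∀ z, (z ∈ A ∨ z ∈ B) → z ≠ c := by
        intro z hz
        rcases hz with hz | hz
        · have := hnotC A hA z hz; rcases hc with rfl | rfl | rfl <;> tauto
        · have := hnotC B hB z hz; rcases hc with rfl | rfl | rfl <;> tauto
      have h1 : p.1 ∈ ({q.1, q.2, c} : Finset α) := by rw [← h']; exact mem_insert_self _ _
      have h2 : p.2 ∈ ({q.1, q.2, c} : Finset α) := by rw [← h']; exact mem_insert_of_mem (mem_insert_self _ _)
      rw [mem_insert, mem_insert, mem_singleton] at h1 h2
      have e1 : p.1 = q.1 := by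
        rcases h1 with h1 | h1 | h1
        · exact h1
        · exact absurd h1 (hAB p.1 hp.1 q.2 hq.2)
        · exact absurd h1 (hnc p.1 (Or.inl hp.1))
      have e2 : p.2 = q.2 := by
        rcases h2 with h2 | h2 | h2
        · exact absurd h2.symm (hAB q.1 hq.1 p.2 hp.2)
        · exact h2
        · exact absurd h2 (hnc p.2 (Or.inr hp.2))
      exact Prod.ext e1 e2
    have hd1 : Disjoint ((Af ×ˢ Ag).image (fun p => ({p.1, p.2, k} : Finset α)))
        ((Af ×ˢ Ak).image (fun p => ({p.1, p.2, g} : Finset α))) := by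
      rw [disjoint_left]
      intro Y hY₁ hY₂
      rw [mem_image] at hY₁ hY₂
      obtain ⟨p, hp, rfl⟩ := hY₁
      obtain ⟨q, hq, h⟩ := hY₂
      rw [mem_product] at hp
      have : g ∈ ({p.1, p.2, k} : Finset α) := by
        rw [← h]; exact mem_insert_of_mem (mem_insert_of_mem (mem_singleton_self g))
      rw [mem_insert, mem_insert, mem_singleton] at this
      rcases this with h' | h' | h'
      · exact (hnotC Af (Or.inl rfl) p.1 hp.1).2.1 h'.symm
      · exact (hnotC Ag (Or.inr (Or.inl rfl)) p.2 hp.2).2.1 h'.symm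
      · exact hgk h'
    have hd2 : Disjoint ((Af ×ˢ Ag).image (fun p => ({p.1, p.2, k} : Finset α)) ∪
          (Af ×ˢ Ak).image (fun p => ({p.1, p.2, g} : Finset α)))
        ((Ag ×ˢ Ak).image (fun p => ({p.1, p.2, f} : Finset α))) := by
      rw [disjoint_left]
      intro Y hY₁ hY₂
      rw [mem_image] at hY₂
      obtain ⟨q, hq, rfl⟩ := hY₂
      rw [mem_union, mem_image, mem_image] at hY₁
      rcases hY₁ with ⟨p, hp, h⟩ | ⟨p, hp, h⟩ <;> rw [mem_product] at hp
      · have : f ∈ ({p.1, p.2, k} : Finset α) := by rw [h]; exact mem_insert_of_mem (mem_insert_of_mem (mem_singleton_self f))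
        rw [mem_insert, mem_insert, mem_singleton] at this
        rcases this with h' | h' | h'
        · exact (hnotC Af (Or.inl rfl) p.1 hp.1).1 h'.symm
        · exact (hnotC Ag (Or.inr (Or.inl rfl)) p.2 hp.2).1 h'.symm
        · exact hfk h'
      · have : f ∈ ({p.1, p.2, g} : Finset α) := by rw [h]; exact mem_insert_of_mem (mem_insert_of_mem (mem_singleton_self f))
        rw [mem_insert, mem_insert, mem_singleton] at this
        rcases this with h' | h' | h'
        · exact (hnotC Af (Or.inl rfl) p.1 hp.1).1 h'.symm
        · exact (hnotC Ak (Or.inr (Or.inr rfl)) p.2 hp.2).1 h'.symm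
        · exact hfg h'
    rw [card_union_of_disjoint hd2, card_union_of_disjoint hd1,
      card_image_of_injOn (hinj Af Ag k (Or.inl rfl) (Or.inr (Or.inl rfl)) (Or.inr (Or.inr rfl))
        (fun z hz z' hz' => (m1 z z' hz hz').2.2)),
      card_image_of_injOn (hinj Af Ak g (Or.inl rfl) (Or.inr (Or.inr rfl)) (Or.inr (Or.inl rfl))
        (fun z hz z' hz' => (m2 z z' hz hz').2.2)),
      card_image_of_injOn (hinj Ag Ak f (Or.inr (Or.inl rfl)) (Or.inr (Or.inr rfl)) (Or.inl rfl)
        (fun z hz z' hz' => (m3 z z' hz hz').2.2)),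
      card_product, card_product, card_product, hAf, hAg, hAk]

/-- **FAMILY THREE**: when `A_c`, the points of `H₀` parallel to a basis point `c`, has `≥ 4` points (on `9` points this
forces `#A_c = 4` and `#(H₀ − A_c) = 2`), the triples `z + (H₀ − A_c)` (`z ∈ A_c`) are bi-spanning, avoid the
basis, and number `#A_c`. -/
theorem exists_family_three (hll : ∀ x ∈ gr R, rk R {x} = 1) (hR3 : rk R (gr R) = 3) (h9 : (gr R).card = 9)
    (hf : f ∈ gr R) (hg : g ∈ gr R) (hk : k ∈ gr R) (hfg : f ≠ g) (hfk : f ≠ k) (hgk : g ≠ k)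
    (hC : rk R {f, g, k} = 3) (hH : rk R (gr R \ {f, g, k}) = 3) {c : α} (hc : c ∈ ({f, g, k} : Finset α))
    (h4 : 4 ≤ ((gr R \ {f, g, k}).filter (fun z => rk R {c, z} = 1)).card) :
    ∃ T₃ ⊆ ((gr R).powersetCard 3).filter (fun Y => rk R Y = 3 ∧ rk R (gr R \ Y) = 3),
      (∀ Y ∈ T₃, (Y ∩ {f, g, k}).card = 0) ∧
      T₃.card = ((gr R \ {f, g, k}).filter (fun z => rk R {c, z} = 1)).card := by
  obtain ⟨H₀, hH₀⟩ : ∃ H₀, H₀ = gr R \ {f, g, k} := ⟨_, rfl⟩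
  obtain ⟨A, hA⟩ : ∃ A, A = (gr R \ {f, g, k}).filter (fun z => rk R {c, z} = 1) := ⟨_, rfl⟩
  rw [← hH₀] at hH h4 ⊢
  rw [← hH₀] at hA
  rw [← hA] at h4 ⊢
  have hcE : c ∈ gr R := by
    simp only [mem_insert, mem_singleton] at hc; rcases hc with rfl | rfl | rfl <;> assumption
  have hCE : ({f, g, k} : Finset α) ⊆ gr R := insert_subset hf (insert_subset hg (singleton_subset_iff.2 hk))
  have hH₀E : H₀ ⊆ gr R := by rw [hH₀]; exact sdiff_subset
  have hAH : A ⊆ H₀ := by rw [hA]; exact filter_subset _ _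
  have hApar : ∀ z ∈ A, rk R {c, z} = 1 := by intro z hz; rw [hA, mem_filter] at hz; exact hz.2
  have hle : ∀ X ⊆ gr R, rk R X ≤ 3 := fun X hX => hR3 ▸ rk_mono' hX
  have hcardH₀ : H₀.card = 6 := by
    rw [hH₀, card_sdiff_of_subset hCE, h9, card_triple_of_ne hfg hfk hgk]
  -- `#(H₀ − A) ≥ 2`, else `H₀` has rank `≤ 2`
  have hrkA : rk R A ≤ 1 := rk_le_one_of_all_parallel hll hcE (hAH.trans hH₀E) hApar
  have hrest : 2 ≤ (H₀ \ A).card := by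
    by_contra hlt
    have h1 : rk R H₀ ≤ rk R (A ∪ (H₀ \ A)) := by
      apply rk_mono'
      intro x hx
      rw [mem_union, mem_sdiff]
      by_cases hxA : x ∈ A
      · exact Or.inl hxA
      · exact Or.inr ⟨hx, hxA⟩
    have h2 := rk_union_le (M := R) A (H₀ \ A)
    have h3 := rk_le_card (M := R) (H₀ \ A)
    omega
  have hcardA : (H₀ \ A).card + A.card = 6 := by
    rw [card_sdiff_of_subset hAH, hcardH₀]
    have := card_le_card hAH
    omega
  have hcard2 : (H₀ \ A).card = 2 := by omega
  -- members
  have hmem : ∀ z ∈ A, insert z (H₀ \ A) ∈ ((gr R).powersetCard 3).filter (fun Y => rk R Y = 3 ∧ rk R (gr R \ Y) = 3) ∧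
      (insert z (H₀ \ A) ∩ {f, g, k}).card = 0 := by
    intro z hz
    have hzE : z ∈ gr R := hH₀E (hAH hz)
    have hzn : z ∉ H₀ \ A := fun h => (mem_sdiff.1 h).2 hz
    have hYH : insert z (H₀ \ A) ⊆ H₀ := insert_subset (hAH hz) sdiff_subset
    refine ⟨?_, ?_⟩
    · rw [mem_filter, mem_powersetCard]
      refine ⟨⟨hYH.trans hH₀E, by rw [card_insert_of_notMem hzn, hcard2]⟩, ?_, ?_⟩
      · -- `H₀ ⊆ cl(Y + c)` and `Y + c` has the rank of `Y`
        have e := rk_insert_eq_of_rk_pair_eq_one hll hzE hcE (by rw [pair_comm]; exact hApar z hz)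
          (hYH.trans hH₀E) (mem_insert_self z _)
        have hsub : H₀ ⊆ clF R (insert c (insert z (H₀ \ A))) := by
          intro x hx
          by_cases hxA : x ∈ A
          · -- `x ∥ c`
            have hxE : x ∈ gr R := hH₀E hx
            rw [mem_clF_iff_rk_insert hxE (insert_subset hcE (hYH.trans hH₀E))]
            exact rk_insert_eq_of_rk_pair_eq_one hll hcE hxE (hApar x hxA) (insert_subset hcE (hYH.trans hH₀E))
              (mem_insert_self c _)
          · exact subset_clF (insert_subset hcE (hYH.trans hH₀E))
              (mem_insert_of_mem (mem_insert_of_mem (mem_sdiff.2 ⟨hx, hxA⟩)))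
        have h1 := rk_mono' (M := R) hsub
        rw [rk_clF, e, hH] at h1
        have h2 := hle _ (hYH.trans hH₀E)
        omega
      · -- the complement contains the basis
        have hsub : ({f, g, k} : Finset α) ⊆ gr R \ insert z (H₀ \ A) := by
          intro x hx
          rw [mem_sdiff]
          refine ⟨hCE hx, fun h => ?_⟩
          have := hYH h
          rw [hH₀, mem_sdiff] at this
          exact this.2 hx
        have h1 := rk_mono' (M := R) hsub
        have h2 := hle _ (sdiff_subset : gr R \ insert z (H₀ \ A) ⊆ gr R)
        omega
    · rw [card_eq_zero, ← disjoint_iff_inter_eq_empty, disjoint_left]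
      intro x hx hxC
      have := hYH hx
      rw [hH₀, mem_sdiff] at this
      exact this.2 hxC
  refine ⟨A.image (fun z => insert z (H₀ \ A)), ?_, ?_, ?_⟩
  · intro Y hY
    rw [mem_image] at hY
    obtain ⟨z, hz, rfl⟩ := hY
    exact (hmem z hz).1
  · intro Y hY
    rw [mem_image] at hY
    obtain ⟨z, hz, rfl⟩ := hY
    exact (hmem z hz).2
  · apply card_image_of_injOn
    intro z₁ hz₁ z₂ _ h
    rw [mem_coe] at hz₁
    have h' : insert z₁ (H₀ \ A) = insert z₂ (H₀ \ A) := h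
    exact (insert_inj (fun h'' => (mem_sdiff.1 h'').2 hz₁)).1 h'

end Families

end PercRepro.Cogirth
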